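import Mathlib
import Literature.Probability.RandomPlanarGeometry.HexParafermion
import Literature.Probability.RandomPlanarGeometry.HexSAW

/-!
# Crux HexObservableLimitR (stmt-CriticalPhenomena-14003) — ideator 3, round 1: first lemmas of the
card `kac-ward-resolvent-dressing` (spin-5/8 Kac–Ward resolvent).

Directed ("arrival-resolved") pieces of the Duminil-Copin–Smirnov observable and the two exact
local identities the card's Dyson equation is built from:

* `arrivalFrom Λ a e w`  — the phased sum over walks `a → e` whose LAST vertex is `w` (they reach the
  mid-edge `e = {w, w'}` travelling from `w` towards `w'`);
* `newArrivalFrom Λ a e w v` / `oldArrivalFrom Λ a e w v` — the same, split according to whether the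
  far endpoint `v` of `e` has already been visited (`old` = the TADPOLE RETURNS, the card's sink field);
* `DysonStep` — one-step transfer: what leaves `v` through the port `w₀` is `x_c` times the
  turn-phased NEW arrivals at `v` through the two other ports (the `c₂` bookkeeping of DCS Lemma 1,
  read as `Ψ_out = T Ψ_in^new`; no self-avoidance is used beyond "v not yet visited");
* `TadpoleNull` — the tadpole-return port vector is DCS-null at every vertex (the `c₁` half of the
  proof of Lemma 1 in isolation: loop reversal, excursion winding `± 5π/3` forced by planarity).

Both Props are provable now (finite bijections on `HexMidEdgeSAW`); they are the `First lemma`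
of the idea card, not route items.
-/

noncomputable section

open scoped BigOperators
open Literature.Probability.LatticeModels Literature.Probability.RandomPlanarGeometry.SAW

namespace Summit.CriticalPhenomena.SAWScalingLimit.Cruxes.HexObservableLimitR.Ideator3

/-- Phased sum over the walks `a → e` of the domain `Λ` whose last visited vertex is `w`
(arrival at the mid-edge `e` FROM `w`), at `x = x_c`, `σ = 5/8`. -/
def arrivalFrom (Λ : Finset HexVertex) (a e : Sym2 HexVertex) (w : HexVertex) : ℂ :=
  ∑ γ : HexMidEdgeSAW Λ a e,
    if γ.verts.getLast? = some w then γ.weight hexCriticalFugacity (5 / 8) else 0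

/-- NEW arrivals: last vertex `w`, and the vertex `v` (the far endpoint of `e = {w, v}`) not yet
visited — exactly the walks that may be continued through `v`. -/
def newArrivalFrom (Λ : Finset HexVertex) (a e : Sym2 HexVertex) (w v : HexVertex) : ℂ :=
  ∑ γ : HexMidEdgeSAW Λ a e,
    if γ.verts.getLast? = some w ∧ v ∉ γ.verts then γ.weight hexCriticalFugacity (5 / 8) else 0

/-- OLD arrivals = TADPOLE RETURNS: last vertex `w`, arriving towards a vertex `v` visited earlier
(the walk passed through `v`, made an excursion and comes back to end on a mid-edge of `v`). This is
the sink field `s_old` of the card's Dyson equation. -/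
def oldArrivalFrom (Λ : Finset HexVertex) (a e : Sym2 HexVertex) (w v : HexVertex) : ℂ :=
  ∑ γ : HexMidEdgeSAW Λ a e,
    if γ.verts.getLast? = some w ∧ v ∈ γ.verts then γ.weight hexCriticalFugacity (5 / 8) else 0

/-- The spin-`5/8` turn phase `e^{-iσ θ}` of the step `w → v → w₀` (θ = ± π/3 on the honeycomb). -/
def turnPhase (w v w₀ : HexVertex) : ℂ :=
  Complex.exp (-(Complex.I * (5 / 8 : ℂ) *
    (Complex.arg ((hexCenter w₀ - hexCenter v) / (hexCenter v - hexCenter w)) : ℂ)))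

/-- **DysonStep** (the transfer equation `Ψ_out = T Ψ_in^new`, one port at a time): for a vertex
`v ∈ Λ` that is not an endpoint of the root mid-edge `a`, with pairwise distinct neighbours
`w₀, w₁, w₂`, the phased sum of walks leaving `v` through the port `w₀` (ending at `{v, w₀}` with last
vertex `v`) equals `x_c` times the turn-phased NEW arrivals at `v` through `w₁` and `w₂`. -/
def DysonStep : Prop :=
  ∀ (Λ : Finset HexVertex), hexDomainSimplyConnected Λ →
    ∀ a ∈ hexDomainBoundary Λ, ∀ v ∈ Λ, v ∉ a →
      ∀ w₀ w₁ w₂ : HexVertex, hexGraph.Adj v w₀ → hexGraph.Adj v w₁ → hexGraph.Adj v w₂ →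
        w₀ ≠ w₁ → w₁ ≠ w₂ → w₀ ≠ w₂ →
          arrivalFrom Λ a s(v, w₀) v =
            (hexCriticalFugacity : ℂ) *
              (turnPhase w₁ v w₀ * newArrivalFrom Λ a s(v, w₁) w₁ v +
               turnPhase w₂ v w₀ * newArrivalFrom Λ a s(v, w₂) w₂ v)

/-- **TadpoleNull** (`c₁` alone): at every vertex the tadpole-return port vector is annihilated by
the Duminil-Copin–Smirnov functional `Σ_j (p_j − v)·(·)` — the sink field of the Dyson equation
lies in the DCS-null subspace, vertex by vertex. -/
def TadpoleNull : Prop :=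
  ∀ (Λ : Finset HexVertex), hexDomainSimplyConnected Λ →
    ∀ a ∈ hexDomainBoundary Λ, ∀ v ∈ Λ,
      ∀ w₀ w₁ w₂ : HexVertex, hexGraph.Adj v w₀ → hexGraph.Adj v w₁ → hexGraph.Adj v w₂ →
        w₀ ≠ w₁ → w₁ ≠ w₂ → w₀ ≠ w₂ →
          (hexMidpoint s(v, w₀) - hexCenter v) * oldArrivalFrom Λ a s(v, w₀) w₀ v +
            (hexMidpoint s(v, w₁) - hexCenter v) * oldArrivalFrom Λ a s(v, w₁) w₁ v +
            (hexMidpoint s(v, w₂) - hexCenter v) * oldArrivalFrom Λ a s(v, w₂) w₂ v = 0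

/-- Sanity decomposition used by the card (definitional bookkeeping, provable by `Finset.sum_ite`):
arrivals split into new and old. -/
def ArrivalSplit : Prop :=
  ∀ (Λ : Finset HexVertex) (a e : Sym2 HexVertex) (w v : HexVertex),
    arrivalFrom Λ a e w = newArrivalFrom Λ a e w v + oldArrivalFrom Λ a e w v

/-- The observable at an interior mid-edge is the sum of its two directed arrivals (every walk of
positive length has a last vertex, which is an endpoint of the final mid-edge). -/
def ObservableEqTwoArrivals : Prop :=
  ∀ (Λ : Finset HexVertex), ∀ a ∈ hexDomainBoundary Λ, ∀ v w : HexVertex, hexGraph.Adj v w →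
    s(v, w) ≠ a →
      hexParafermionicObservable Λ a hexCriticalFugacity (5 / 8) s(v, w) =
        arrivalFrom Λ a s(v, w) v + arrivalFrom Λ a s(v, w) w

end Summit.CriticalPhenomena.SAWScalingLimit.Cruxes.HexObservableLimitR.Ideator3
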